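import Summits.Ventures.HodgeRepro.SingleClass

/-!
# The cyclic recipe, part 1 of 3: half-interval arithmetic on `ℕ` and the membership rule

Blind re-derivation cell `pub-hodge-repro`, seat `p1` (gen 9; split by p1 gen 10 at section boundaries for the cell's
≤ 400-line landing rule, declaration text unchanged).  The recipe type on `ℤ/2rpq` is cut out by a half-interval rule
on natural representatives: this part is the pure-`ℕ` arithmetic behind it (the half-interval predicates, their
periodicity and complement rules) and the membership rule `InPhi r p q` with its `mod`-invariance.  Part 2
(`CyclicRecipeMain.lean`) builds the type, the involution and the twists on `ℤ/N` and proves the CM condition,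
`SumTwo`, primitivity and the absence of a conjugate pair; part 3 (`CyclicRecipe.lean`, the module importers see)
adds the Pohlmann `4`-set, the `m`-form and the numeric instances.  Mathematics and statements: see part 3's docstring.
-/

set_option autoImplicit false

open Finset
open scoped Pointwise

namespace HodgeRepro.CyclicRecipe

/-! ### Half-interval arithmetic on `ℕ` -/

/-- `(v + n) mod 2n < n` exactly when `v mod 2n ≥ n`: the half-interval `[0, n)` of `ℤ/2n` is flipped by the shift `n`. -/
theorem half_flip {n : ℕ} (hn : 0 < n) (v : ℕ) : (v + n) % (2 * n) < n ↔ ¬ v % (2 * n) < n := by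
  have h2 : 0 < 2 * n := by omega
  have hw : v % (2 * n) < 2 * n := Nat.mod_lt _ h2
  have hn' : n % (2 * n) = n := Nat.mod_eq_of_lt (by omega)
  rw [Nat.add_mod, hn']
  by_cases h : v % (2 * n) < n
  · rw [Nat.mod_eq_of_lt (by omega)]; omega
  · rw [Nat.mod_eq_sub_mod (by omega), Nat.mod_eq_of_lt (by omega)]; omega

/-- Two points of the half-interval `[0, n) ⊂ ℤ/2n` at distance `δ` exist unless `δ ≡ n (mod 2n)`. -/
theorem exists_half_pair {n : ℕ} (hn : 0 < n) {δ : ℕ} (hδ : δ % (2 * n) ≠ n) :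
    ∃ k, k % (2 * n) < n ∧ (k + δ) % (2 * n) < n := by
  have h2 : 0 < 2 * n := by omega
  have hρ : δ % (2 * n) < 2 * n := Nat.mod_lt _ h2
  by_cases h : δ % (2 * n) < n
  · exact ⟨0, by rw [Nat.zero_mod]; exact hn, by rw [Nat.zero_add]; exact h⟩
  · refine ⟨2 * n - δ % (2 * n), ?_, ?_⟩
    · rw [Nat.mod_eq_of_lt (by omega)]; omega
    · have hd := Nat.div_add_mod δ (2 * n)
      have e : 2 * n - δ % (2 * n) + δ = 2 * n * (δ / (2 * n) + 1) := by
        rw [Nat.mul_add, Nat.mul_one]; omega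
      rw [e, Nat.mul_mod_right]; exact hn

/-- `(y₀ + r k) mod 2rn = y₀ + r (k mod 2n)` for `y₀ < r`: the residue of a point of the class `y₀ (mod r)` modulo `2rn`
is read off `k mod 2n`. -/
theorem class_mod {r n y₀ k : ℕ} (hy : y₀ < r) (hn : 0 < n) :
    (y₀ + r * k) % (2 * (r * n)) = y₀ + r * (k % (2 * n)) := by
  have hk := Nat.div_add_mod k (2 * n)
  have e : y₀ + r * k = y₀ + r * (k % (2 * n)) + 2 * (r * n) * (k / (2 * n)) := by
    conv_lhs => rw [← hk]
    ring
  have h1 : k % (2 * n) + 1 ≤ 2 * n := Nat.mod_lt _ (by omega)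
  have h2 : r * (k % (2 * n) + 1) ≤ r * (2 * n) := Nat.mul_le_mul_left r h1
  have h3 : r * (2 * n) = 2 * (r * n) := by ring
  rw [e, Nat.add_mul_mod_self_left, Nat.mod_eq_of_lt]
  rw [mul_add_one] at h2
  omega

/-- `y₀ + r j < r n ↔ j < n` for `y₀ < r`. -/
theorem class_half {r n y₀ j : ℕ} (hy : y₀ < r) : y₀ + r * j < r * n ↔ j < n := by
  constructor
  · intro h
    by_contra hc
    have hc' : n ≤ j := Nat.le_of_not_lt hc
    have := Nat.mul_le_mul_left r hc'
    omega
  · intro h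
    have := Nat.mul_le_mul_left r (Nat.succ_le_of_lt h)
    rw [Nat.mul_succ] at this
    omega

/-- Shifting `k₀` by `s (2n − 1)` and then by `s` does not change the residue mod `2n`. -/
theorem shift_mod {n s k₀ : ℕ} (hn : 0 < n) : (k₀ + s * (2 * n - 1) + s) % (2 * n) = k₀ % (2 * n) := by
  have e : s * (2 * n - 1) + s = 2 * n * s := by
    rw [← Nat.mul_succ, Nat.succ_eq_add_one, Nat.sub_add_cancel (by omega : 1 ≤ 2 * n), Nat.mul_comm]
  rw [Nat.add_assoc, e, Nat.add_mul_mod_self_left]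

/-! ### The membership rule -/

/-- The membership rule of the recipe type on the natural representative `v` of an element of `ℤ/2rpq`: on the residue
class `1 (mod r)` the half-interval rule modulo `P₂ = 2rp`, on every other class the half-interval rule modulo `P₁ = 2rq`. -/
def InPhi (r p q v : ℕ) : Prop :=
  if v % r = 1 then v % (2 * (r * p)) < r * p else v % (2 * (r * q)) < r * q

/-- The rule is decidable. -/
instance (r p q v : ℕ) : Decidable (InPhi r p q v) := by
  unfold InPhi; infer_instance

/-- The rule is insensitive to reduction modulo any common multiple `N` of `r`, `2rp`, `2rq`. -/
theorem inPhi_mod {N r p q v : ℕ} (hr : r ∣ N) (hp : 2 * (r * p) ∣ N) (hq : 2 * (r * q) ∣ N) :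
    InPhi r p q (v % N) ↔ InPhi r p q v := by
  unfold InPhi
  rw [Nat.mod_mod_of_dvd v hr, Nat.mod_mod_of_dvd v hp, Nat.mod_mod_of_dvd v hq]

/-- Outside the class `1`, the shift by `rq` flips membership. -/
theorem inPhi_add_rq {r p q v : ℕ} (hr0 : 0 < r) (hq0 : 0 < q) (hv : v % r ≠ 1) :
    InPhi r p q (v + r * q) ↔ ¬ InPhi r p q v := by
  have h1 : (v + r * q) % r = v % r := Nat.add_mul_mod_self_left v r q
  simp only [InPhi, h1, hv, ↓reduceIte]
  exact half_flip (Nat.mul_pos hr0 hq0) v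

/-- On the class `1`, the shift by `rp` flips membership. -/
theorem inPhi_add_rp {r p q v : ℕ} (hr0 : 0 < r) (hp0 : 0 < p) (hv : v % r = 1) :
    InPhi r p q (v + r * p) ↔ ¬ InPhi r p q v := by
  have h1 : (v + r * p) % r = v % r := Nat.add_mul_mod_self_left v r p
  simp only [InPhi, h1, hv, ↓reduceIte]
  exact half_flip (Nat.mul_pos hr0 hp0) v

/-- The shift by `m = rpq` flips membership everywhere (`p`, `q` odd): the CM condition. -/
theorem inPhi_add_half {r p q v : ℕ} (hr0 : 0 < r) (hp : Odd p) (hq : Odd q) :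
    InPhi r p q (v + r * p * q) ↔ ¬ InPhi r p q v := by
  have hp0 : 0 < p := hp.pos
  have hq0 : 0 < q := hq.pos
  obtain ⟨kp, hkp⟩ := hp
  obtain ⟨kq, hkq⟩ := hq
  have hmod : (v + r * p * q) % r = v % r := by
    rw [mul_assoc]; exact Nat.add_mul_mod_self_left v r (p * q)
  by_cases hv : v % r = 1
  · have e : v + r * p * q = (v + r * p) + 2 * (r * p) * kq := by rw [hkq]; ring
    have h2 : (v + r * p * q) % (2 * (r * p)) = (v + r * p) % (2 * (r * p)) := by
      rw [e, Nat.add_mul_mod_self_left]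
    simp only [InPhi, hmod, hv, ↓reduceIte, h2]
    exact half_flip (Nat.mul_pos hr0 hp0) v
  · have e : v + r * p * q = (v + r * q) + 2 * (r * q) * kp := by rw [hkp]; ring
    have h2 : (v + r * p * q) % (2 * (r * q)) = (v + r * q) % (2 * (r * q)) := by
      rw [e, Nat.add_mul_mod_self_left]
    simp only [InPhi, hmod, hv, ↓reduceIte, h2]
    exact half_flip (Nat.mul_pos hr0 hq0) v

/-- Membership on a class `y₀ ≠ 1 (mod r)`: `y₀ + r k ∈ Φ ↔ k mod 2q < q`. -/
theorem inPhi_class {r p q y₀ k : ℕ} (hy : y₀ < r) (hy1 : y₀ ≠ 1) (hq0 : 0 < q) :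
    InPhi r p q (y₀ + r * k) ↔ k % (2 * q) < q := by
  have h0 : (y₀ + r * k) % r = y₀ := by rw [Nat.add_mul_mod_self_left]; exact Nat.mod_eq_of_lt hy
  simp only [InPhi, h0, hy1, ↓reduceIte]
  rw [class_mod hy hq0, class_half hy]

/-- Membership on the class `1 (mod r)`: `1 + r k ∈ Φ ↔ k mod 2p < p` (for `r ≥ 2`). -/
theorem inPhi_class1 {r p q k : ℕ} (hr : 2 ≤ r) (hp0 : 0 < p) :
    InPhi r p q (1 + r * k) ↔ k % (2 * p) < p := by
  have h1 : (1 + r * k) % r = 1 := by rw [Nat.add_mul_mod_self_left]; exact Nat.mod_eq_of_lt (by omega)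
  simp only [InPhi, h1, ↓reduceIte]
  rw [class_mod (by omega) hp0, class_half (by omega)]

/-- Membership on the class `0 (mod r)`: `r k ∈ Φ ↔ k mod 2q < q` (for `r ≥ 2`). -/
theorem inPhi_class0 {r p q k : ℕ} (hr : 2 ≤ r) (hq0 : 0 < q) :
    InPhi r p q (r * k) ↔ k % (2 * q) < q := by
  have := inPhi_class (p := p) (y₀ := 0) (k := k) (by omega : 0 < r) (by omega) hq0
  rwa [Nat.zero_add] at this


end HodgeRepro.CyclicRecipe
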